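import Summits.QuantumFields.QCD.Theses.HeatSlicedQuarks
import Literature.MathematicalPhysics.QuantumFieldTheory.FermionFlow

/-!
# Sketch (crux-ideate round 1, ideator 2) — crux `SmallFieldUltracontractivity`
(item stmt-QuantumFields-8871, route HeatSlicedQuarks).

Typed FIRST LEMMA (and the stubs foreseen right after it) for the ONE idea card this seat files:

* card `diamagnetic-gagliardo-nirenberg` : `DiamagneticGagliardoNirenberg` (first lemma),
  `DiamagneticGagliardoNirenbergColour` (spin-free twin over the tree's `covariantLaplacian`),
  `InteriorBochnerAPriori` (stub 2), `HalfTimeSupBound` (the T*T form the two combine into).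

A second card (`holonomy-renormalised-lclt`: Chapman–Kolmogorov dyadic renormalisation around the
transported free kernel) was WITHDRAWN before filing (see this seat's NOTES.md `## Barrier notes` 1 and 4:
prefactor-free exterior leakage forces K ≳ √(log r) on every kernel-envelope induction). Its elementary
vocabulary — `RectangleStokes` (non-abelian Stokes in deficit form, existing decls only), the posited
`axisTransport`/`combTransport`, and `CombTriangleDefect` — is kept below because it is true, cheap, and
reusable by any line that needs Gaussian-triangle holonomy bounds (e.g. off-diagonal upgrades of the crux).

Nothing here is proved; every `def … : Prop` must merely elaborate (`lean check` rc 0).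
Conventions: `wilsonDirac ρ U m 1` is the tree's r = 1 Wilson operator; `H_U = D_Wᴴ D_W`;
`K_U ⊗ 1_spin = wilsonDirac ρ U 0 1 + (wilsonDirac ρ U 0 1)ᴴ = -(covariantLaplacian ρ U) ⊗ 1`
(twice the Hermitian part of the massless operator is the covariant lattice Laplacian, spin-blind).
-/

namespace Summit.QuantumFields.QCD.Cruxes.SmallFieldUltracontractivity.Ideator2

open Literature.MathematicalPhysics.QuantumLattice Literature.MathematicalPhysics.QuantumFieldTheory
open Literature.Probability.LatticeModels Matrix
open scoped BigOperators Matrix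

noncomputable section

/-- colour–spin index of quark fields on the `L⁴` torus -/
abbrev Idx (L : ℕ) : Type := TorusSite 4 L × Fin 3 × Fin 4

/-- the gauge group `SU(3)` as used by the crux -/
abbrev SU3 : Type := Matrix.specialUnitaryGroup (Fin 3) ℂ

/-- `K_U ⊗ 1_spin`: the spin-blind covariant lattice Laplacian `Σ_μ ∇_μ^† ∇_μ ≥ 0` on colour–spin
fields, written with existing declarations as `D_W(U,0,1) + D_W(U,0,1)ᴴ`. -/
def covLapSpin {L : ℕ} [NeZero L] (U : GaugeConfig 4 L SU3) : Matrix (Idx L) (Idx L) ℂ :=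
  wilsonDirac (fundamentalRep (Fin 3)) U 0 1 + (wilsonDirac (fundamentalRep (Fin 3)) U 0 1)ᴴ

/-- `H_U = D_W(U,m,1)ᴴ D_W(U,m,1)`, the operator whose heat kernel the crux bounds. -/
def hW {L : ℕ} [NeZero L] (U : GaugeConfig 4 L SU3) (m : ℝ) : Matrix (Idx L) (Idx L) ℂ :=
  (wilsonDirac (fundamentalRep (Fin 3)) U m 1)ᴴ * wilsonDirac (fundamentalRep (Fin 3)) U m 1

/-- `ℓ²` norm of a colour–spin field. -/
def l2 {L : ℕ} [NeZero L] (v : Idx L → ℂ) : ℝ := Real.sqrt (∑ i, ‖v i‖ ^ 2)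

/-- The crux's small-field hypothesis on the `torusDist`-ball of radius `R` about `x`
with plaquette deficit bound `δ²` (the crux uses `R = K r`, `δ = ε / r²`). -/
def SmallFieldOn {L : ℕ} [NeZero L] (U : GaugeConfig 4 L SU3) (x : TorusSite 4 L) (R : ℕ) (δ : ℝ) : Prop :=
  ∀ y : TorusSite 4 L, torusDist x y ≤ R → ∀ μ ν : Fin 4,
    3 - ((fundamentalRep (Fin 3)) (plaquetteHolonomy U y μ ν)).trace.re ≤ δ ^ 2

/-! ## Card 1 — `diamagnetic-gagliardo-nirenberg` -/

/-- **FIRST LEMMA (card `diamagnetic-gagliardo-nirenberg`). U-UNIFORM DIAMAGNETIC GAGLIARDO–NIRENBERG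
INEQUALITY in `d = 4`.** For EVERY `SU(3)` lattice gauge field (no smallness whatsoever), every
colour–spin field `g`, every `s ≥ 1` and every index `i = (x,a,α)`:
`|g(x,a,α)| ≤ C (s⁻¹ + L⁻²) (‖g‖₂ + s² ‖K_U² g‖₂)`.
Mechanism: write `1 = ψ(sK_U) + (sK_U)² η(sK_U)` with `ψ(u) = Σ_j a_j e^{-σ_j u}` (`Σ a_j = 1`,
`Σ a_j σ_j = 0`) and `η(u) = (1-ψ(u))/u² = ∫₀^{σ_max} w(σ) e^{-σu} dσ` (`w` bounded, `w(σ) = σ`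
near `0`); every `e^{-uK_U}` is dominated ENTRYWISE IN FIBRE NORM by the free scalar heat kernel
`e^{-uK}` (lattice Kato–Simon: the hopping part of `K_U` is a sum of unitary parallel transports),
and `‖e^{-uK}(x,·)‖₂ = e^{-2uK}(x,x)^{1/2} ≤ C (u⁻¹ + L⁻²)` on the 4-torus. This is the only place
an `L² → L^∞` step happens on the whole line, and it costs nothing in `U`. -/
def DiamagneticGagliardoNirenberg : Prop :=
  ∃ C : ℝ, ∀ (L : ℕ) [NeZero L] (U : GaugeConfig 4 L SU3) (g : Idx L → ℂ) (s : ℝ), 1 ≤ s →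
    ∀ i : Idx L,
      ‖g i‖ ≤ C * (1 / s + 1 / (L : ℝ) ^ 2) *
        (l2 g + s ^ 2 * l2 ((covLapSpin U * covLapSpin U).mulVec g))

/-- The same inequality stated over the tree's spin-free `covariantLaplacian` (Lüscher's `Δ[U]`,
`FermionFlow.lean`), for colour vector fields; equivalent to the above slice by slice in spin. -/
def DiamagneticGagliardoNirenbergColour : Prop :=
  ∃ C : ℝ, ∀ (L : ℕ) [NeZero L] (U : GaugeConfig 4 L SU3) (g : TorusSite 4 L × Fin 3 → ℂ) (s : ℝ),
    1 ≤ s → ∀ p : TorusSite 4 L × Fin 3,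
      ‖g p‖ ≤ C * (1 / s + 1 / (L : ℝ) ^ 2) *
        (Real.sqrt (∑ q, ‖g q‖ ^ 2) + s ^ 2 * Real.sqrt (∑ q,
          ‖(covariantLaplacian (fundamentalRep (Fin 3)) U *
              covariantLaplacian (fundamentalRep (Fin 3)) U).mulVec g q‖ ^ 2))

/-- **Stub 2 (where the plaquette smallness enters, and ONLY through commutators).
INTERIOR BOCHNER A-PRIORI ESTIMATE.** Under the crux's hypothesis on `B(x, K r)`, for every scale
`1 ≤ ρ ≤ r` there is a `[0,1]`-valued site cutoff `χ` with `χ(x) = 1` such that for EVERY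
colour–spin field `g` (no spectral or support condition)
`‖K_U² (χ g)‖₂ ≤ C (‖H_U² g‖₂ + ρ⁻² ‖H_U g‖₂ + ρ⁻⁴ ‖g‖₂)`.
Content: the exact algebra `H_U = m² + (m+1) K_U + ¼ Σ_{μ≠ν} K_μ K_ν + V_F` where `V_F` is a finite
`γ`-linear combination of commutators `[T_ν^♯, T_μ^♯]` (`μ ≠ ν`) of the unitary transports, each
the operator `f ↦ (1 - U_p)·(double shift of f)` of norm `≤ ‖1 - U_p‖_F ≤ √2 ε/r²` on the ball
(uses only `T_μ` unitary and `S_μ^† S_μ = K_μ(4 - K_μ)` exactly); then Gårding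
(`H_U ≥ ½ K_U + m² + (m+½)K_U + … `, i.e. the route's `WilsonLichnerowicz`, needs `m ≥ -1/2`),
the Bochner identities `‖K_U h‖ ≤ 2‖H_U h‖ + curvature`, `‖K_U² h‖ ≤ 4‖H_U² h‖ + curvature`
(each commutator of covariant differences is a plaquette defect `≤ √2 ε/r² ≤ √2 ε ρ⁻²`), and a
product cutoff at scale `ρ` whose commutators cost `ρ⁻¹` per difference. -/
def InteriorBochnerAPriori : Prop :=
  ∃ ε : ℝ, 0 < ε ∧ ∃ K : ℕ, ∃ C : ℝ, ∀ (L : ℕ) [NeZero L] (U : GaugeConfig 4 L SU3) (m : ℝ),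
    m ∈ Set.Icc (-(1 / 2 : ℝ)) 1 → ∀ (x : TorusSite 4 L) (r : ℕ), 1 ≤ r → r ≤ L →
      SmallFieldOn U x (K * r) (ε / (r : ℝ) ^ 2) →
        ∀ ρ : ℕ, 1 ≤ ρ → ρ ≤ r →
          ∃ χ : TorusSite 4 L → ℝ, (∀ y, 0 ≤ χ y ∧ χ y ≤ 1) ∧ χ x = 1 ∧
            ∀ g : Idx L → ℂ,
              l2 ((covLapSpin U * covLapSpin U).mulVec (fun i => (χ i.1 : ℂ) * g i)) ≤
                C * (l2 ((hW U m * hW U m).mulVec g) + l2 ((hW U m).mulVec g) / (ρ : ℝ) ^ 2 +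
                  l2 g / (ρ : ℝ) ^ 4)

/-- **T*T form of the crux** (honest equivalence, shared with every interior-regularity line):
`|(e^{-(t/2) H_U} f)(x,a,α)| ≤ (C/t) ‖f‖₂` for `1 ≤ t ≤ r²`; the crux follows with constant `C²`
because `e^{-tH}(x·,x·) ` is the Gram matrix of the vectors `e^{-(t/2)H} δ_{(x,b,β)}`.
`DiamagneticGagliardoNirenberg` (with `s = t`) + `InteriorBochnerAPriori` (with `ρ = ⌊√t⌋`) +
the elementary parabolic smoothing `‖H^k e^{-(t/2)H}‖ ≤ (2k/(e t))^k` (valid for every PSD `H`)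
give it in three lines. -/
def HalfTimeSupBound : Prop :=
  ∃ ε : ℝ, 0 < ε ∧ ∃ K : ℕ, ∃ C : ℝ, ∀ (L : ℕ) [NeZero L] (U : GaugeConfig 4 L SU3) (m : ℝ),
    m ∈ Set.Icc (-(1 / 2 : ℝ)) 1 → ∀ (x : TorusSite 4 L) (r : ℕ), 1 ≤ r → r ≤ L →
      SmallFieldOn U x (K * r) (ε / (r : ℝ) ^ 2) →
        ∀ t : ℝ, 1 ≤ t → t ≤ (r : ℝ) ^ 2 → ∀ (f : Idx L → ℂ) (a : Fin 3) (α : Fin 4),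
          ‖(NormedSpace.exp (-((t / 2 : ℝ) : ℂ) • hW U m)).mulVec f (x, a, α)‖ ≤ C / t * l2 f

/-- sanity: the crux decl is in scope under its route name (the line must conclude it BY NAME). -/
example : Prop := Summit.QuantumFields.QCD.Theses.HeatSlicedQuarks.SmallFieldUltracontractivity

/-! ## Vocabulary of the withdrawn card `holonomy-renormalised-lclt` (kept: true and reusable) -/

/-- **(withdrawn card's first lemma) NON-ABELIAN STOKES FOR RECTANGLES in deficit form, existing declarations only:**
`√(3 - Re tr W_{R×T}(x)) ≤ Σ_{a<R} Σ_{b<T} √(3 - Re tr U_p(x + a eᵢ + b eⱼ))`,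
because `‖1 - W‖_F ≤ Σ_p ‖1 - U_p‖_F` (the rectangle holonomy is an ordered product of `R·T`
lassoed plaquettes, conjugation by unitaries preserves `‖·‖_F`, and `‖1 - V‖_F² = 2(3 - Re tr V)`
on `SU(3)`). Under the crux's hypothesis every `√t × √t` rectangle in the ball has deficit
`≤ (ε t / r²)²`: the holonomy of a Gaussian-typical triangle at time `t` is `ε t/r²`-close to `1`,
which is how the background enters any transport-based comparison — and is `≤ ε` exactly up to the
crux's top scale `t = r²`. -/
def RectangleStokes : Prop :=
  ∀ (L : ℕ) [NeZero L] (U : GaugeConfig 4 L SU3) (x : TorusSite 4 L) (i j : Fin 4), i ≠ j →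
    ∀ R T : ℕ,
      Real.sqrt (3 - ((fundamentalRep (Fin 3)) (rectangleHolonomy U x i j R T)).trace.re) ≤
        ∑ a ∈ Finset.range R, ∑ b ∈ Finset.range T,
          Real.sqrt (3 - ((fundamentalRep (Fin 3))
            (plaquetteHolonomy U (x + Pi.single i (a : ZMod L) + Pi.single j (b : ZMod L)) i j)).trace.re)

/-- Straight transport along axis `k` from `y` by the torus offset `δ`, the short way round:
forward `δ.val` steps if `δ.val ≤ L/2`, else backward `L - δ.val` steps (posited object; built from
the tree's `lineHolonomy`; maps the colour fibre at `y + δ e_k` to the fibre at `y`). -/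
def axisTransport {L : ℕ} [NeZero L] (U : GaugeConfig 4 L SU3) (k : Fin 4) (y : TorusSite 4 L)
    (δ : ZMod L) : SU3 :=
  if δ.val ≤ L / 2 then lineHolonomy U k δ.val y
  else (lineHolonomy U k (L - δ.val) (y + Pi.single k δ))⁻¹

/-- COMB TRANSPORT `𝒰(y,z)`: parallel transport from the fibre at `z` to the fibre at `y` along
the rectilinear path that exhausts axis `0` first, then `1`, `2`, `3` (posited object). -/
def combTransport {L : ℕ} [NeZero L] (U : GaugeConfig 4 L SU3) (y z : TorusSite 4 L) : SU3 :=
  let δ : TorusSite 4 L := z - y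
  let y₁ := y + Pi.single 0 (δ 0)
  let y₂ := y₁ + Pi.single 1 (δ 1)
  let y₃ := y₂ + Pi.single 2 (δ 2)
  axisTransport U 0 y (δ 0) * axisTransport U 1 y₁ (δ 1) * axisTransport U 2 y₂ (δ 2) *
    axisTransport U 3 y₃ (δ 3)

/-- **(withdrawn card) GAUSSIAN-TRIANGLE HOLONOMY DEFECT.** Commuting the
segments of `comb(z→w)` leftward past those of `comb(y→z)` sweeps rectangles of total area
`≤ |z-y|₁ |w-z|₁ ≤ 16 d(y,z) d(z,w)` inside the bounding box of `{y,z,w}`, so by `RectangleStokes`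
`‖ρ(𝒰(y,z) 𝒰(z,w) 𝒰(y,w)⁻¹) - 1‖ ≤ 16 √2 δ · d(y,z) · d(z,w)` whenever the plaquettes of that box
have deficit `≤ δ²` and the box does not wrap. This is the error term of the Chapman–Kolmogorov
step `G_t^𝒰 ∘ G_t^𝒰 = G_{2t}^𝒰 + O(δ t)` for the transported free kernel
`G_t^𝒰(y,z) = g_t(y-z) ρ(𝒰(y,z))`. -/
def CombTriangleDefect : Prop :=
  ∃ C : ℝ, ∀ (L : ℕ) [NeZero L] (U : GaugeConfig 4 L SU3) (x : TorusSite 4 L) (R : ℕ) (δ : ℝ),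
    0 ≤ δ → 8 * R < L → SmallFieldOn U x (2 * R) δ →
      ∀ y z w : TorusSite 4 L, torusDist x y ≤ R → torusDist x z ≤ R → torusDist x w ≤ R →
        ∀ a b : Fin 3,
          ‖((fundamentalRep (Fin 3))
              (combTransport U y z * combTransport U z w * (combTransport U y w)⁻¹) - 1) a b‖ ≤
            C * δ * (torusDist y z : ℝ) * (torusDist z w : ℝ)

end

end Summit.QuantumFields.QCD.Cruxes.SmallFieldUltracontractivity.Ideator2
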